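import Literature.Analysis.FluidPDE.SuitableWeak
import HarnessLib

/-!
# Route HardyPointSink — `HardyAncientLimit`, step 4: the Hardy bound passes to pointwise limits

Support file for item stmt-NavierStokesRegularity-9138 (`HardyAncientLimit`) of route
`HardyPointSink` (problem `NavierStokesRegularity`).

Two measure-theoretic bookkeeping lemmas, independent of the Navier–Stokes equations:

* `HardyAncientLimit.lintegral_hardy_le_of_tendsto` — **Fatou for the Hardy energy**: if
  `F_j → g` pointwise on `ℝ³`, the balls `B_j` eventually contain every point, and
  `∫_{B_j} ‖F_j‖² / |y − y₀| ≤ K` for all large `j`, then `∫ ‖g‖² / |y − y₀| ≤ K`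
  (`lintegral_liminf_le'`; the weight is positive off the null set `{y₀}`).
* `HardyAncientLimit.lintegral_ball_sq_le_of_hardy` — **Hardy ⇒ Morrey**: a Hardy bound at the
  centre `0`, `∫ ‖g‖² / |y| ≤ K`, gives `∫_{B(0, m)} ‖g‖² ≤ K m` (on the ball `|y|⁻¹ ≥ m⁻¹`).

## References

* D. Albritton, T. Barker, arXiv:1811.00502, §3 (scale-invariant bounds are inherited by the
  blow-up limit).
-/

noncomputable section

open MeasureTheory Set Function Filter Topology Metric
open scoped ENNReal NNReal

namespace Summit.NavierStokesRegularity.NavierStokesRegularity.Theorems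

namespace HardyAncientLimit

/-- **Fatou for the Hardy energy.** Let `F_j, g : ℝ³ → ℝ³` with `F_j` a.e.-strongly measurable
and `F_j(y) → g(y)` for every `y`; let `B_j` be measurable sets which eventually contain every
point; and suppose `∫_{B_j} ‖F_j‖² / ‖y − y₀‖ ≤ K` for all large `j`. Then
`∫ ‖g‖² / ‖y − y₀‖ ≤ K` (all integrals in `ℝ≥0∞`). [folklore] -/
theorem lintegral_hardy_le_of_tendsto
    {F : ℕ → EuclideanSpace ℝ (Fin 3) → EuclideanSpace ℝ (Fin 3)}
    {g : EuclideanSpace ℝ (Fin 3) → EuclideanSpace ℝ (Fin 3)} {y₀ : EuclideanSpace ℝ (Fin 3)}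
    {K : ℝ≥0∞} (hmeas : ∀ j, AEStronglyMeasurable (F j) volume)
    (hlim : ∀ y, Tendsto (fun j => F j y) atTop (𝓝 (g y)))
    {B : ℕ → Set (EuclideanSpace ℝ (Fin 3))} (hB : ∀ j, MeasurableSet (B j))
    (hexh : ∀ y, ∀ᶠ j in atTop, y ∈ B j)
    (hbound : ∀ᶠ j in atTop, ∫⁻ y in B j, ‖F j y‖ₑ ^ 2 / ‖y - y₀‖ₑ ≤ K) :
    ∫⁻ y, ‖g y‖ₑ ^ 2 / ‖y - y₀‖ₑ ≤ K := by
  set f : ℕ → EuclideanSpace ℝ (Fin 3) → ℝ≥0∞ := fun j y =>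
    (B j).indicator (fun y => ‖F j y‖ₑ ^ 2 / ‖y - y₀‖ₑ) y with hf
  have hwm : Measurable fun y : EuclideanSpace ℝ (Fin 3) => ‖y - y₀‖ₑ :=
    (measurable_id.sub_const y₀).enorm
  have hfm : ∀ j, AEMeasurable (f j) volume := fun j =>
    (((hmeas j).aemeasurable.enorm.pow_const 2).div hwm.aemeasurable).indicator (hB j)
  -- pointwise, off `y₀`, `f j y → ‖g y‖² / ‖y - y₀‖`
  have hkey : ∀ᵐ y ∂(volume : Measure (EuclideanSpace ℝ (Fin 3))),
      liminf (fun j => f j y) atTop = ‖g y‖ₑ ^ 2 / ‖y - y₀‖ₑ := by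
    filter_upwards [compl_mem_ae_iff.2 (measure_singleton y₀)] with y hy
    have hy' : y ≠ y₀ := fun h => hy (mem_singleton_iff.2 h)
    have hne : ‖y - y₀‖ₑ ≠ 0 := by
      rw [ne_eq, enorm_eq_zero, sub_eq_zero]
      exact hy'
    have h1 : Tendsto (fun j => ‖F j y‖ₑ ^ 2 / ‖y - y₀‖ₑ) atTop
        (𝓝 (‖g y‖ₑ ^ 2 / ‖y - y₀‖ₑ)) := by
      have h0 : Tendsto (fun j => ‖F j y‖ₑ) atTop (𝓝 ‖g y‖ₑ) :=
        (continuous_enorm.tendsto _).comp (hlim y)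
      exact ENNReal.Tendsto.div_const (ENNReal.Tendsto.pow h0) (Or.inr hne)
    have h2 : (fun j => f j y) =ᶠ[atTop] fun j => ‖F j y‖ₑ ^ 2 / ‖y - y₀‖ₑ := by
      filter_upwards [hexh y] with j hj
      simp only [hf, indicator_of_mem hj]
    exact (h1.congr' h2.symm).liminf_eq
  calc ∫⁻ y, ‖g y‖ₑ ^ 2 / ‖y - y₀‖ₑ = ∫⁻ y, liminf (fun j => f j y) atTop :=
        lintegral_congr_ae (hkey.mono fun y hy => hy.symm)
    _ ≤ liminf (fun j => ∫⁻ y, f j y) atTop := lintegral_liminf_le' hfm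
    _ = liminf (fun j => ∫⁻ y in B j, ‖F j y‖ₑ ^ 2 / ‖y - y₀‖ₑ) atTop := by
        refine liminf_congr (Eventually.of_forall fun j => ?_)
        rw [hf, lintegral_indicator (hB j)]
    _ ≤ K := liminf_le_of_frequently_le' (hbound.frequently)

/-- **Hardy ⇒ Morrey at the origin.** If `∫ ‖g‖² / ‖y‖ ≤ K` then `∫_{B(0, m)} ‖g‖² ≤ K m` for
every `m > 0` (on the ball, `m⁻¹ ≤ ‖y‖⁻¹`). [folklore] -/
theorem lintegral_ball_sq_le_of_hardy
    {g : EuclideanSpace ℝ (Fin 3) → EuclideanSpace ℝ (Fin 3)} {K : ℝ≥0∞}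
    (h : ∫⁻ y, ‖g y‖ₑ ^ 2 / ‖y - 0‖ₑ ≤ K) {m : ℝ} (hm : 0 < m) :
    ∫⁻ y in ball (0 : EuclideanSpace ℝ (Fin 3)) m, ‖g y‖ₑ ^ 2 ≤ K * ENNReal.ofReal m := by
  have hm0 : ENNReal.ofReal m ≠ 0 := by simpa using hm
  have hmt : ENNReal.ofReal m ≠ ⊤ := ENNReal.ofReal_ne_top
  -- `m⁻¹ ∫_{B(0,m)} ‖g‖² ≤ ∫_{B(0,m)} ‖g‖²/‖y‖ ≤ K`
  have h1 : (ENNReal.ofReal m)⁻¹ * ∫⁻ y in ball (0 : EuclideanSpace ℝ (Fin 3)) m, ‖g y‖ₑ ^ 2 ≤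
      ∫⁻ y in ball (0 : EuclideanSpace ℝ (Fin 3)) m, ‖g y‖ₑ ^ 2 / ‖y - 0‖ₑ := by
    rw [← lintegral_const_mul' _ _ (ENNReal.inv_ne_top.2 hm0)]
    refine setLIntegral_mono' measurableSet_ball fun y hy => ?_
    rw [div_eq_mul_inv, mul_comm]
    refine mul_le_mul' le_rfl ?_
    rw [ENNReal.inv_le_inv, ← ofReal_norm, ← dist_eq_norm]
    exact ENNReal.ofReal_le_ofReal (le_of_lt (mem_ball.1 hy))
  have h2 : (ENNReal.ofReal m)⁻¹ * ∫⁻ y in ball (0 : EuclideanSpace ℝ (Fin 3)) m, ‖g y‖ₑ ^ 2 ≤ K :=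
    (h1.trans (setLIntegral_le_lintegral _ _)).trans h
  calc ∫⁻ y in ball (0 : EuclideanSpace ℝ (Fin 3)) m, ‖g y‖ₑ ^ 2
      = ENNReal.ofReal m * ((ENNReal.ofReal m)⁻¹ *
          ∫⁻ y in ball (0 : EuclideanSpace ℝ (Fin 3)) m, ‖g y‖ₑ ^ 2) := by
        rw [← mul_assoc, ENNReal.mul_inv_cancel hm0 hmt, one_mul]
    _ ≤ ENNReal.ofReal m * K := mul_le_mul' le_rfl h2
    _ = K * ENNReal.ofReal m := mul_comm _ _

end HardyAncientLimit

end Summit.NavierStokesRegularity.NavierStokesRegularity.Theorems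

end
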